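import Literature.AlgebraicGeometry.Morphisms.CechModuleH2
import Mathlib.AlgebraicGeometry.Morphisms.Separated
import HarnessLib

/-!
# Transfer of the vanishing of `Ȟ²` along a morphism of modules which is bijective on the
# intersections of distinct members

Sequel of `Literature/AlgebraicGeometry/Morphisms/CechModuleH2` (the full ordered Čech complex of a
sheaf of `𝒪_X`-modules `M` on a family of opens `𝒰 = (U_i)` of an `A`-scheme `f : X → Spec A`, in
degrees `≤ 3`, and `Ȟ²(𝒰, M) = Ž²/B̌²`).  For a morphism `φ : M → N` of `𝒪_X`-modules we prove:

* `exists_sub_mem_cechMB2_and_diag_eq_zero` — **normalisation of `2`-cocycles**: every `2`-cocycle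
  `z` is cohomologous to a `2`-cocycle `z'` with vanishing diagonal components `z'_{iii} = 0`
  (subtract `d¹` of the `1`-cochain `c_{ij} = z_{iij}|`; `(d¹ c)_{iii} = z_{iii}`);
* `cechMZ2_le_cechMB2_of_app_bijective` — if `φ` is bijective on the sections over the triple
  intersections `U_i ∩ U_j ∩ U_k` with `(i, j, k)` NOT constant and injective over the non-constant
  quadruple intersections, then `Ž²(𝒰, M) ⊆ B̌²(𝒰, M)` implies `Ž²(𝒰, N) ⊆ B̌²(𝒰, N)` (normalise, lift
  componentwise through the bijections — the diagonal components being `0` — and push a primitive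
  forward);
* `cechMZ2_le_cechMB2_of_app_bijective'` — if `φ` is bijective over the pairwise intersections
  `U_i ∩ U_j`, `i ≠ j`, and injective over the non-constant triple intersections, then
  `Ž²(𝒰, N) ⊆ B̌²(𝒰, N)` implies `Ž²(𝒰, M) ⊆ B̌²(𝒰, M)` (normalise, push forward, take a primitive
  `c` of `φ z'` — its diagonal `c_{ii}` vanishes automatically — and pull it back componentwise);
* `cechMZ2_le_cechMB2_iff_of_app_bijective`, `subsingleton_cechMH2_iff_of_app_bijective` — hence
  `Ȟ²(𝒰, M) = 0 ↔ Ȟ²(𝒰, N) = 0` when `φ` is bijective over all intersections of members with at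
  least two distinct indices;
* `subsingleton_cechMH2_iff_of_app_bijective_of_le` — the geometric form: `X` separated, the `U_i`
  affine, an open `Ω` containing `U_i ∩ U_j` for all `i ≠ j`, and `φ` bijective on the sections
  over every AFFINE open contained in `Ω`.

Typical use (this is what the file is for): `φ` is an isomorphism away from a finite set `F` of
closed points and the cover is chosen so that every point of `F` lies in exactly one member; e.g.
the unit `M → r_* r^* M` of a morphism `r : S′ → X` which is an isomorphism over `X ∖ F`
(`Morphisms/UnitIsoOver.unit_app_bijective_of_le`), or a morphism whose kernel and cokernel are
supported on `F`.  No affineness, quasi-coherence or finiteness is needed for the combinatorial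
statements: they are identities in the full ordered Čech complex (The Stacks Project, Tag 01ED),
and the only input is the cocycle identity and `d² ∘ d¹ = 0`.  Everything is proved; no named
facts; no definitions.  Mathlib searched (pin v4.32): no Čech cohomology of sheaves of modules on
schemes (cf. `CechModule.lean`); `Equiv.ofBijective`, `IsAffineOpen.inf` (used).

## References

* The Stacks Project, Tag 01ED (Cohomology, Section 20.9: the Čech complex and its functoriality
  in the sheaf). [StacksProject]
* R. Hartshorne, *Algebraic Geometry*, GTM 52 (1977), III §4 (Čech cohomology), Lemma 4.4 and the
  proof of Thm. 4.5 (p. 222) for the style of componentwise diagram chase. [Hartshorne1977]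
-/

noncomputable section

open CategoryTheory AlgebraicGeometry Limits TopologicalSpace Opposite

universe u v

namespace Literature.AlgebraicGeometry.Morphisms

variable {A : Type u} [CommRing A] {X : Scheme.{u}} (f : X ⟶ Spec (.of A)) (M : X.Modules)
  {ι : Type v} (U : ι → X.Opens)

/-! ## Normalisation of `2`-cocycles: killing the diagonal components -/

section Normalise

/-- `U_i ∩ U_j ⊆ U_i ∩ U_i ∩ U_j`. [folklore] -/
private theorem inf_le_iij (i j : ι) : U i ⊓ U j ≤ U i ⊓ U i ⊓ U j :=
  le_inf (le_inf inf_le_left inf_le_left) inf_le_right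

/-- Restricting from `U_i ∩ U_i` to `U_i ∩ U_i ∩ U_i` and back is the identity, so the first
restriction is injective (in the form: it reflects `0`). [folklore] -/
private theorem eq_zero_of_res_iii_eq_zero (i : ι) (x : MSections f M (U i ⊓ U i))
    (h : ∀ hle : U i ⊓ U i ⊓ U i ≤ U i ⊓ U i, MSections.res f M hle x = 0) : x = 0 := by
  have h1 := congrArg (MSections.res f M (inf_le_iij U i i)) (h inf_le_left)
  rw [MSections.res_res, map_zero] at h1
  rw [← MSections.res_self f M x]
  exact h1

/-- **The diagonal component of `d¹` of the cochain `c_{ij} = z_{iij}|` is `z_{iii}`.** [folklore] -/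
private theorem cechMD1_diag_apply_iii (z : CechMC2 f M U) (i : ι) :
    cechMD1 f M U (fun i j => MSections.res f M (inf_le_iij U i j) (z i i j)) i i i = z i i i := by
  rw [cechMD1_apply]
  simp only [MSections.res_res]
  rw [MSections.res_eq_res f M _ (le_refl _) (z i i i), MSections.res_self]
  abel

/-- **Normalisation of `2`-cocycles**: every `2`-cocycle `z` of `M` on `𝒰` differs by a
`2`-coboundary from a `2`-cocycle `z'` whose diagonal components `z'_{iii}` all vanish (namely
`z' = z - d¹ c` with `c_{ij} = z_{iij}|_{U_i ∩ U_j}`).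
[cite: StacksProject, Tag 01ED (Cohomology, Section 20.9)] -/
theorem exists_sub_mem_cechMB2_and_diag_eq_zero {z : CechMC2 f M U} (hz : z ∈ cechMZ2 f M U) :
    ∃ z' : CechMC2 f M U, z' ∈ cechMZ2 f M U ∧ z - z' ∈ cechMB2 f M U ∧ ∀ i, z' i i i = 0 := by
  set c : CechMC1 f M U := fun i j => MSections.res f M (inf_le_iij U i j) (z i i j) with hc
  have hB : cechMD1 f M U c ∈ cechMB2 f M U := (mem_cechMB2_iff f M U _).mpr ⟨c, rfl⟩
  refine ⟨z - cechMD1 f M U c, Submodule.sub_mem _ hz (cechMB2_le_cechMZ2 f M U hB), ?_, ?_⟩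
  · rw [sub_sub_cancel]
    exact hB
  · intro i
    rw [Pi.sub_apply, Pi.sub_apply, Pi.sub_apply, hc, cechMD1_diag_apply_iii, sub_self]

end Normalise

/-! ## Transfer along `φ : M → N` -/

section Transfer

variable {M} {N : X.Modules} (φ : M ⟶ N)

/-- **From `M` to `N`**: if `φ : M → N` is bijective on the sections over the non-constant triple
intersections `U_i ∩ U_j ∩ U_k` and injective over the non-constant quadruple intersections, and
every `2`-cocycle of `M` on `𝒰` is a `2`-coboundary, then so is every `2`-cocycle of `N` on `𝒰`.
Proof: normalise the cocycle so that `z_{iii} = 0`; lift it componentwise through the bijections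
(and by `0` on the diagonal); the lift is a cocycle (check through `φ`, which is injective where
the check is not trivial); push a primitive forward.
[cite: StacksProject, Tag 01ED (Cohomology, Section 20.9)] -/
theorem cechMZ2_le_cechMB2_of_app_bijective
    (h₃ : ∀ i j k, ¬ (i = j ∧ j = k) →
      Function.Bijective (MSections.app f φ (U i ⊓ U j ⊓ U k)))
    (h₄ : ∀ i j k l, ¬ (i = j ∧ j = k ∧ k = l) →
      Function.Injective (MSections.app f φ (U i ⊓ U j ⊓ U k ⊓ U l)))
    (hM : cechMZ2 f M U ≤ cechMB2 f M U) : cechMZ2 f N U ≤ cechMB2 f N U := by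
  classical
  intro z hz
  obtain ⟨z', hz', hzz', hdiag⟩ := exists_sub_mem_cechMB2_and_diag_eq_zero f N U hz
  -- componentwise lift of the normalised cocycle
  set m : CechMC2 f M U := fun i j k =>
    if h : (i = j ∧ j = k) then 0
    else (Equiv.ofBijective _ (h₃ i j k h)).symm (z' i j k) with hm
  have hφm : cechMapC2 f φ U m = z' := by
    funext i j k
    rw [cechMapC2_apply, hm]
    by_cases h : (i = j ∧ j = k)
    · obtain ⟨rfl, rfl⟩ := h
      simp only [and_self, dite_true, map_zero]
      exact (hdiag i).symm
    · simp only [h, dite_false]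
      exact Equiv.ofBijective_apply_symm_apply _ (h₃ i j k h) (z' i j k)
  -- the lift is a cocycle
  have hmZ : m ∈ cechMZ2 f M U := by
    rw [mem_cechMZ2_iff]
    funext i j k l
    rw [Pi.zero_apply, Pi.zero_apply, Pi.zero_apply, Pi.zero_apply]
    by_cases h : (i = j ∧ j = k ∧ k = l)
    · obtain ⟨rfl, rfl, rfl⟩ := h
      rw [cechMD2_apply]
      have hle : U i ⊓ U i ⊓ U i ⊓ U i ≤ U i ⊓ U i ⊓ U i := inf_le_left
      rw [MSections.res_eq_res f M _ hle (m i i i)]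
      abel
    · apply h₄ i j k l h
      rw [map_zero, ← cechMapC3_apply, ← cechMD2_mapC2, hφm]
      have := (mem_cechMZ2_iff f N U z').mp hz'
      rw [this]
      rfl
  -- a primitive of the lift pushes forward to a primitive of `z'`
  obtain ⟨c, hc⟩ := (mem_cechMB2_iff f M U m).mp (hM hmZ)
  have hz'B : z' ∈ cechMB2 f N U := by
    rw [mem_cechMB2_iff]
    refine ⟨cechMapC1 f φ U c, ?_⟩
    rw [cechMD1_mapC1, hc, hφm]
  have hsum : z = (z - z') + z' := by abel
  rw [hsum]
  exact Submodule.add_mem _ hzz' hz'B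

/-- **From `N` to `M`**: if `φ : M → N` is bijective on the sections over the pairwise intersections
`U_i ∩ U_j`, `i ≠ j`, and injective over the non-constant triple intersections, and every
`2`-cocycle of `N` on `𝒰` is a `2`-coboundary, then so is every `2`-cocycle of `M` on `𝒰`.
Proof: normalise the cocycle `m` of `M` so that `m_{iii} = 0`; a primitive `c` of `φ m` has
`c_{ii}|_{U_i ∩ U_i ∩ U_i} = (d¹ c)_{iii} = φ m_{iii} = 0`, hence `c_{ii} = 0`; pull `c` back
componentwise through the bijections (and by `0` on the diagonal); its `d¹` is `m` (check through
`φ`). [cite: StacksProject, Tag 01ED (Cohomology, Section 20.9)] -/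
theorem cechMZ2_le_cechMB2_of_app_bijective'
    (h₂ : ∀ i j, i ≠ j → Function.Bijective (MSections.app f φ (U i ⊓ U j)))
    (h₃ : ∀ i j k, ¬ (i = j ∧ j = k) →
      Function.Injective (MSections.app f φ (U i ⊓ U j ⊓ U k)))
    (hN : cechMZ2 f N U ≤ cechMB2 f N U) : cechMZ2 f M U ≤ cechMB2 f M U := by
  classical
  intro m hm
  obtain ⟨m', hm', hmm', hdiag⟩ := exists_sub_mem_cechMB2_and_diag_eq_zero f M U hm
  obtain ⟨cN, hcN⟩ := (mem_cechMB2_iff f N U _).mp (hN (mapC2_mem_cechMZ2 f φ U hm'))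
  -- the diagonal of the primitive vanishes
  have hcNii : ∀ i, cN i i = 0 := by
    intro i
    apply eq_zero_of_res_iii_eq_zero f N U i
    intro hle
    have h := congrFun (congrFun (congrFun hcN i) i) i
    rw [cechMapC2_apply, hdiag i, map_zero, cechMD1_apply] at h
    rw [MSections.res_eq_res f N _ hle (cN i i)] at h
    have key : ∀ a : MSections f N (U i ⊓ U i ⊓ U i), a - a + a = 0 → a = 0 := by
      intro a ha
      rwa [sub_self, zero_add] at ha
    exact key _ h
  -- componentwise pull-back of the primitive
  set cM : CechMC1 f M U := fun i j =>
    if h : i = j then 0 else (Equiv.ofBijective _ (h₂ i j h)).symm (cN i j) with hcM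
  have hφc : cechMapC1 f φ U cM = cN := by
    funext i j
    rw [cechMapC1_apply, hcM]
    by_cases h : i = j
    · subst h
      simp only [dite_true, map_zero]
      exact (hcNii i).symm
    · simp only [h, dite_false]
      exact Equiv.ofBijective_apply_symm_apply _ (h₂ i j h) (cN i j)
  have hd : cechMD1 f M U cM = m' := by
    funext i j k
    by_cases h : (i = j ∧ j = k)
    · obtain ⟨rfl, rfl⟩ := h
      rw [hdiag i, cechMD1_apply]
      have hii : cM i i = 0 := by rw [hcM]; exact dif_pos rfl
      simp only [hii, map_zero, sub_zero, zero_add]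
    · apply h₃ i j k h
      rw [← cechMapC2_apply, ← cechMD1_mapC1, hφc, hcN, cechMapC2_apply]
  have hm'B : m' ∈ cechMB2 f M U := (mem_cechMB2_iff f M U m').mpr ⟨cM, hd⟩
  have hsum : m = (m - m') + m' := by abel
  rw [hsum]
  exact Submodule.add_mem _ hmm' hm'B

/-- **`Ž² ⊆ B̌²` transfers both ways along a morphism bijective over all intersections of members
with at least two distinct indices** (pairs `i ≠ j`, non-constant triples and quadruples).
[cite: StacksProject, Tag 01ED (Cohomology, Section 20.9)] -/
theorem cechMZ2_le_cechMB2_iff_of_app_bijective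
    (h₂ : ∀ i j, i ≠ j → Function.Bijective (MSections.app f φ (U i ⊓ U j)))
    (h₃ : ∀ i j k, ¬ (i = j ∧ j = k) →
      Function.Bijective (MSections.app f φ (U i ⊓ U j ⊓ U k)))
    (h₄ : ∀ i j k l, ¬ (i = j ∧ j = k ∧ k = l) →
      Function.Injective (MSections.app f φ (U i ⊓ U j ⊓ U k ⊓ U l))) :
    cechMZ2 f M U ≤ cechMB2 f M U ↔ cechMZ2 f N U ≤ cechMB2 f N U :=
  ⟨cechMZ2_le_cechMB2_of_app_bijective f U φ h₃ h₄,
    cechMZ2_le_cechMB2_of_app_bijective' f U φ h₂ fun i j k h => (h₃ i j k h).1⟩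

/-- **`Ȟ²(𝒰, M) = 0 ↔ Ȟ²(𝒰, N) = 0`** for a morphism `φ : M → N` bijective on the sections over all
intersections of members of `𝒰` with at least two distinct indices.
[cite: StacksProject, Tag 01ED (Cohomology, Section 20.9)] -/
theorem subsingleton_cechMH2_iff_of_app_bijective
    (h₂ : ∀ i j, i ≠ j → Function.Bijective (MSections.app f φ (U i ⊓ U j)))
    (h₃ : ∀ i j k, ¬ (i = j ∧ j = k) →
      Function.Bijective (MSections.app f φ (U i ⊓ U j ⊓ U k)))
    (h₄ : ∀ i j k l, ¬ (i = j ∧ j = k ∧ k = l) →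
      Function.Injective (MSections.app f φ (U i ⊓ U j ⊓ U k ⊓ U l))) :
    Subsingleton (CechMH2 f M U) ↔ Subsingleton (CechMH2 f N U) := by
  rw [subsingleton_cechMH2_iff, subsingleton_cechMH2_iff]
  exact cechMZ2_le_cechMB2_iff_of_app_bijective f U φ h₂ h₃ h₄

end Transfer

/-! ## Geometric form: bijectivity over the affine opens inside an open `Ω ⊇ U_i ∩ U_j` (`i ≠ j`) -/

section Affine

variable {M} {N : X.Modules} (φ : M ⟶ N) [X.IsSeparated] (hU : ∀ i, IsAffineOpen (U i))
  (Ω : X.Opens) (hΩ : ∀ i j, i ≠ j → U i ⊓ U j ≤ Ω)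
  (hφ : ∀ V : X.Opens, IsAffineOpen V → V ≤ Ω → Function.Bijective (MSections.app f φ V))

include hU hΩ hφ

omit [X.IsSeparated] hU hφ in
/-- A non-constant triple intersection lies in `Ω`. [folklore] -/
private theorem inf₃_le_of_not_const {i j k : ι} (h : ¬ (i = j ∧ j = k)) :
    U i ⊓ U j ⊓ U k ≤ Ω := by
  by_cases hij : i = j
  · subst hij
    have hik : i ≠ k := fun hik => h ⟨rfl, hik⟩
    exact (inf_le_inf_right (U k) inf_le_left).trans (hΩ i k hik)
  · exact inf_le_left.trans (hΩ i j hij)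

omit [X.IsSeparated] hU hφ in
/-- A non-constant quadruple intersection lies in `Ω`. [folklore] -/
private theorem inf₄_le_of_not_const {i j k l : ι} (h : ¬ (i = j ∧ j = k ∧ k = l)) :
    U i ⊓ U j ⊓ U k ⊓ U l ≤ Ω := by
  by_cases hijk : (i = j ∧ j = k)
  · obtain ⟨rfl, rfl⟩ := hijk
    have hil : i ≠ l := fun hil => h ⟨rfl, rfl, hil⟩
    exact (inf_le_inf_right (U l) (inf_le_right : U i ⊓ U i ⊓ U i ≤ U i)).trans (hΩ i l hil)
  · exact inf_le_left.trans (inf₃_le_of_not_const U Ω hΩ hijk)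

/-- Bijectivity over `U_i ∩ U_j`, `i ≠ j`. [folklore] -/
private theorem app_bijective_inf₂_of_le {i j : ι} (h : i ≠ j) :
    Function.Bijective (MSections.app f φ (U i ⊓ U j)) :=
  hφ _ ((hU i).inf (hU j)) (hΩ i j h)

/-- Bijectivity over the non-constant triple intersections. [folklore] -/
private theorem app_bijective_inf₃_of_le {i j k : ι} (h : ¬ (i = j ∧ j = k)) :
    Function.Bijective (MSections.app f φ (U i ⊓ U j ⊓ U k)) :=
  hφ _ (((hU i).inf (hU j)).inf (hU k)) (inf₃_le_of_not_const U Ω hΩ h)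

/-- Bijectivity over the non-constant quadruple intersections. [folklore] -/
private theorem app_bijective_inf₄_of_le {i j k l : ι} (h : ¬ (i = j ∧ j = k ∧ k = l)) :
    Function.Bijective (MSections.app f φ (U i ⊓ U j ⊓ U k ⊓ U l)) :=
  hφ _ ((((hU i).inf (hU j)).inf (hU k)).inf (hU l)) (inf₄_le_of_not_const U Ω hΩ h)

/-- **`Ȟ²(𝒰, M) = 0 ↔ Ȟ²(𝒰, N) = 0` for a morphism which is bijective away from the points met by
a single member**: `X` separated, the `U_i` affine, `Ω` an open with `U_i ∩ U_j ⊆ Ω` for all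
`i ≠ j` (e.g. `Ω = X ∖ F` for a finite set `F` of points each lying in exactly one `U_i`), and
`φ : M → N` bijective on the sections over every affine open contained in `Ω` (e.g. the unit
`M → r_* r^* M` of a morphism `r` which is an isomorphism over `Ω`, for `M` quasi-coherent:
`unit_app_bijective_of_le` of `Morphisms/UnitIsoOver`).
[cite: StacksProject, Tag 01ED (Cohomology, Section 20.9)] -/
theorem subsingleton_cechMH2_iff_of_app_bijective_of_le :
    Subsingleton (CechMH2 f M U) ↔ Subsingleton (CechMH2 f N U) :=
  subsingleton_cechMH2_iff_of_app_bijective f U φ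
    (fun _ _ h => app_bijective_inf₂_of_le f U φ hU Ω hΩ hφ h)
    (fun _ _ _ h => app_bijective_inf₃_of_le f U φ hU Ω hΩ hφ h)
    (fun _ _ _ _ h => (app_bijective_inf₄_of_le f U φ hU Ω hΩ hφ h).1)

/-- The same in the `Ž² ⊆ B̌²` form. [cite: StacksProject, Tag 01ED (Cohomology, Section 20.9)] -/
theorem cechMZ2_le_cechMB2_iff_of_app_bijective_of_le :
    cechMZ2 f M U ≤ cechMB2 f M U ↔ cechMZ2 f N U ≤ cechMB2 f N U :=
  cechMZ2_le_cechMB2_iff_of_app_bijective f U φ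
    (fun _ _ h => app_bijective_inf₂_of_le f U φ hU Ω hΩ hφ h)
    (fun _ _ _ h => app_bijective_inf₃_of_le f U φ hU Ω hΩ hφ h)
    (fun _ _ _ _ h => (app_bijective_inf₄_of_le f U φ hU Ω hΩ hφ h).1)

end Affine

end Literature.AlgebraicGeometry.Morphisms

end
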